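import Literature.AlgebraicGeometry.Motives.TateConjectureDominatedVarieties
import Literature.AlgebraicGeometry.Motives.FrobeniusDominatedVarieties
import Mathlib.RepresentationTheory.Semisimple
import Mathlib.RepresentationTheory.Intertwining
import HarnessLib

/-!
# Galois representations of dominated varieties: semisimplicity and invariants descend
(Tate 1994 §1; Kleiman 1968 Prop. 1.2.4)

Let `E` be a Galois Weil cohomology theory (the tree's `GaloisWeilCohomology`, Tate 1994 §1) and
`f : V ⟶ U` a morphism of smooth projective varieties with `f* : Hⁱ(U) → Hⁱ(V)` injective — as is
the case when `U` is *dominated* by `V` (`f₊ ζ ≠ 0` for a rational algebraic class `ζ ∈ Aʳ(V)_ℚ`,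
`dim V = dim U + r`; Kleiman 1968 Prop. 1.2.4; this lane's `pullback_injective_of_pushforward_ne_zero`)
and for the factors of a product (`pullback_fst_injective`). Since `f*` is Galois equivariant
(axiom `pullback_ρ`), `Hⁱ(U)` is a subrepresentation of `Hⁱ(V)`:

* **Tate's semisimplicity conjecture `Sⁱ` descends**: `Sⁱ(V) ⇒ Sⁱ(U)`
  (`tateSemisimplicityFor_of_pullback_injective`, `…_of_pushforward_ne_zero`,
  `…_of_pullback_top_ne_zero`, `…_of_tensor_left/right`; a subrepresentation of a completely
  reducible representation is completely reducible, Mathlib `IsSemisimpleModule.of_injective`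
  through `Representation.IntertwiningMap.equivLinearMapAsModule`), so the pair
  `Tᵖ ∧ S²ᵖ` of Tate 1994 §1 descends to dominated varieties
  (`tateConjectureFor_and_semisimplicity_of_pushforward_ne_zero`);
* **dimensions of invariants do not increase**: `dim (H²ᵖ(U)(p))^Γ ≤ dim (H²ᵖ(V)(p))^Γ`,
  `dim Tateᵖ(U) ≤ dim Tateᵖ(V)` and `dim K·Aᵖ(U) ≤ dim K·Aᵖ(V)` (`finrank_invariants_le_…`,
  `finrank_tateClasses_le_…`, `finrank_algebraicClasses_le_…`; `f*` restricts to injective maps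
  of these subspaces, `pullback_mem_invariants`, `pullback_mem_tateClasses`,
  `pullback_ratAlgebraicClasses_le`).

Theorems only; no new definitions, no named facts.

## References

* [Tate1994] J. Tate, *Conjectures on algebraic cycles in ℓ-adic cohomology*, in: Motives,
  Proc. Sympos. Pure Math. 55.1 (1994), §1.
* [Kleiman1968AlgebraicCycles] S. Kleiman, *Algebraic cycles and the Weil conjectures*, in: Dix
  exposés sur la cohomologie des schémas (1968), §1.2 Prop. 1.2.4.
-/

universe u v

open CategoryTheory AlgebraicGeometry MonoidalCategory CartesianMonoidalCategory

noncomputable section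

namespace Literature.AlgebraicGeometry.Motives

/-! ## Linear algebra: a subrepresentation of a semisimple representation is semisimple -/

/-- A representation admitting an injective intertwining map into a completely reducible
representation is completely reducible (Mathlib: intertwining maps are `k[G]`-linear maps,
`IsSemisimpleModule.of_injective`). Local copy of the tree's
`isSemisimpleRepresentation_of_injective` (`NumberTheory/DiophantineGeometry/GLPolynomialRepSemisimpleProofs`),
kept here to avoid that import. [folklore] -/
private theorem isSemisimpleRepresentation_of_injective_aux {K : Type u} [Field K] {G : Type v}
    [Monoid G] {V₁ : Type*} [AddCommGroup V₁] [Module K V₁] {V₂ : Type*} [AddCommGroup V₂]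
    [Module K V₂] {ρ : Representation K G V₁} {σ : Representation K G V₂}
    (f : ρ.IntertwiningMap σ) (hf : Function.Injective f) (h : σ.IsSemisimpleRepresentation) :
    ρ.IsSemisimpleRepresentation := by
  rw [Representation.isSemisimpleRepresentation_iff_isSemisimpleModule_asModule] at h ⊢
  exact IsSemisimpleModule.of_injective
    (Representation.IntertwiningMap.equivLinearMapAsModule (ρ := ρ) (σ := σ) f)
    fun v w hvw ↦ hf hvw

namespace WeilCohomology

variable {k : Type u} [Field k] {K : Type v} [Field K] [CharZero K] (W : WeilCohomology k K)
variable {N M n m r : ℕ} {V U X Z : SchemeOver k}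

/-! ## `dim K·Aᵖ(U) ≤ dim K·Aᵖ(V)` -/

/-- **The rank of the group of algebraic classes does not increase under injective pull-back**:
`dim_K K·Aᵖ(U) ≤ dim_K K·Aᵖ(V)` for `f : V ⟶ U` with `f*` injective on `H²ᵖ(U)` (pull-backs of
algebraic classes are algebraic, axiom `pullback_ratAlgebraicClasses_le`; Kleiman 1968 §1.2 (C)).
[cite: Kleiman1968AlgebraicCycles, §1.2 (C) and Prop. 1.2.4] -/
theorem finrank_algebraicClasses_le_of_pullback_injective (hV : IsSmoothProjective N V)
    (hU : IsSmoothProjective M U) (f : V ⟶ U) {p : ℕ}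
    (hinj : Function.Injective (W.pullback f (2 * p))) :
    Module.finrank K (W.algebraicClasses U p) ≤ Module.finrank K (W.algebraicClasses V p) := by
  haveI := W.finite_obj hV (2 * p)
  have hle : ∀ x ∈ W.algebraicClasses U p, W.pullback f (2 * p) x ∈ W.algebraicClasses V p :=
    fun x hx ↦ W.map_algebraicClasses_le_of_ratAlgebraicClasses _
      (fun y hy ↦ W.pullback_ratAlgebraicClasses_le hV hU f p ⟨y, hy, rfl⟩) ⟨x, hx, rfl⟩
  exact LinearMap.finrank_le_finrank_of_injective (f := (W.pullback f (2 * p)).restrict hle)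
    fun a b h ↦ Subtype.ext (hinj (congrArg Subtype.val h))

/-- `dim K·Aᵖ(U) ≤ dim K·Aᵖ(V)` for `U` dominated by `V` (`f₊ ζ ≠ 0`, `ζ ∈ Aʳ(V)_ℚ`; Kleiman 1968
Prop. 1.2.4). [cite: Kleiman1968AlgebraicCycles, §1.2 Prop. 1.2.4] -/
theorem finrank_algebraicClasses_le_of_pushforward_ne_zero (hV : IsSmoothProjective N V)
    (hU : IsSmoothProjective M U) (f : V ⟶ U) {ζ : W.obj V (2 * r)}
    (hζ : ζ ∈ W.ratAlgebraicClasses V r) {he : 2 * r + 2 * M = 2 * N} {hd : 0 + 2 * M = 2 * M}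
    (hne : W.pushforward (N := N) hU f he hd ζ ≠ 0) (p : ℕ) :
    Module.finrank K (W.algebraicClasses U p) ≤ Module.finrank K (W.algebraicClasses V p) :=
  W.finrank_algebraicClasses_le_of_pullback_injective hV hU f
    (W.pullback_injective_of_pushforward_ne_zero hV hU f hζ hne (2 * p))

/-- `dim K·Aᵖ(X) ≤ dim K·Aᵖ(X × Z)` for all smooth projective `X`, `Z` (`pr_X^*` injective).
[cite: Kleiman1968AlgebraicCycles, §1.2 Prop. 1.2.4] -/
theorem finrank_algebraicClasses_le_tensor (hX : IsSmoothProjective n X)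
    (hZ : IsSmoothProjective m Z) (p : ℕ) :
    Module.finrank K (W.algebraicClasses X p) ≤ Module.finrank K (W.algebraicClasses (X ⊗ Z) p) :=
  W.finrank_algebraicClasses_le_of_pullback_injective (IsSmoothProjective.tensor_holds hX hZ) hX
    (fst X Z) (W.pullback_fst_injective hX hZ (2 * p))

end WeilCohomology

namespace GaloisWeilCohomology

variable {k : Type u} [Field k] {K : Type v} [Field K] [CharZero K]
  {χ : Field.absoluteGaloisGroup k →* Kˣ} (E : GaloisWeilCohomology k K χ)
variable {N M n m r : ℕ} {V U X Z : SchemeOver k}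

/-! ## Semisimplicity descends -/

/-- **A subrepresentation of a semisimple Galois representation is semisimple**: if
`f* : Hⁱ(U) → Hⁱ(V)` is injective (it is Galois equivariant, axiom `pullback_ρ`) and `Hⁱ(V)` is a
completely reducible `Gal(k̄/k)`-representation, then so is `Hⁱ(U)` (Tate 1994 §1, conjecture
`Sⁱ`). [cite: Tate1994, §1] -/
theorem tateSemisimplicityFor_of_pullback_injective (hV : IsSmoothProjective N V)
    (hU : IsSmoothProjective M U) (f : V ⟶ U) {i : ℕ} (hinj : Function.Injective (E.pullback f i))
    (hS : E.TateSemisimplicityFor V i) : E.TateSemisimplicityFor U i :=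
  isSemisimpleRepresentation_of_injective_aux
    ((E.pullback f i).intertwiningMap_of_isIntertwiningMap (E.ρ U i) (E.ρ V i)
      fun g v ↦ (congr($(E.pullback_ρ hV hU f i g) v)).symm)
    hinj hS

/-- **`Sⁱ(V) ⇒ Sⁱ(U)` for `U` dominated by `V`** (`f₊ ζ ≠ 0` for some `ζ ∈ Aʳ(V)_ℚ`, so `f*` is
injective; Kleiman 1968 Prop. 1.2.4). [cite: Tate1994, §1] [cite: Kleiman1968AlgebraicCycles, §1.2 Prop. 1.2.4] -/
theorem tateSemisimplicityFor_of_pushforward_ne_zero (hV : IsSmoothProjective N V)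
    (hU : IsSmoothProjective M U) (f : V ⟶ U) {ζ : E.obj V (2 * r)}
    (hζ : ζ ∈ E.ratAlgebraicClasses V r) {he : 2 * r + 2 * M = 2 * N} {hd : 0 + 2 * M = 2 * M}
    (hne : E.pushforward (N := N) hU f he hd ζ ≠ 0) {i : ℕ} (hS : E.TateSemisimplicityFor V i) :
    E.TateSemisimplicityFor U i :=
  E.tateSemisimplicityFor_of_pullback_injective hV hU f
    (E.pullback_injective_of_pushforward_ne_zero hV hU f hζ hne i) hS

/-- **`Sⁱ(V) ⇒ Sⁱ(U)` along a morphism of non-zero degree** (`V`, `U` of the same dimension,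
`f* ≠ 0` on `H²ᴺ(U)`). [cite: Tate1994, §1] [cite: Kleiman1968AlgebraicCycles, §1.2 Prop. 1.2.4] -/
theorem tateSemisimplicityFor_of_pullback_top_ne_zero (hV : IsSmoothProjective N V)
    (hU : IsSmoothProjective N U) (f : V ⟶ U) (hf : E.pullback f (2 * N) ≠ 0) {i : ℕ}
    (hS : E.TateSemisimplicityFor V i) : E.TateSemisimplicityFor U i :=
  E.tateSemisimplicityFor_of_pullback_injective hV hU f
    (E.pullback_injective_of_pullback_top_ne_zero hV hU f hf i) hS

/-- **`Sⁱ(X × Z) ⇒ Sⁱ(X)`** (`pr_X^*` is injective). [cite: Tate1994, §1] -/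
theorem tateSemisimplicityFor_of_tensor_left (hX : IsSmoothProjective n X)
    (hZ : IsSmoothProjective m Z) {i : ℕ} (hS : E.TateSemisimplicityFor (X ⊗ Z) i) :
    E.TateSemisimplicityFor X i :=
  E.tateSemisimplicityFor_of_pullback_injective (IsSmoothProjective.tensor_holds hX hZ) hX (fst X Z)
    (E.pullback_fst_injective hX hZ i) hS

/-- **`Sⁱ(X × Z) ⇒ Sⁱ(Z)`** (`pr_Z^*` is injective). [cite: Tate1994, §1] -/
theorem tateSemisimplicityFor_of_tensor_right (hX : IsSmoothProjective n X)
    (hZ : IsSmoothProjective m Z) {i : ℕ} (hS : E.TateSemisimplicityFor (X ⊗ Z) i) :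
    E.TateSemisimplicityFor Z i :=
  E.tateSemisimplicityFor_of_pullback_injective (IsSmoothProjective.tensor_holds hX hZ) hZ (snd X Z)
    (E.pullback_snd_injective hX hZ i) hS

/-- **Tate's pair `Tᵖ ∧ S²ᵖ` descends to dominated varieties**: if `V` satisfies Tate's conjecture
`Tᵖ(V)` and the semisimplicity `S²ᵖ(V)`, then so does every `U` dominated by `V`
(`tateConjectureFor_of_pushforward_ne_zero`, `tateSemisimplicityFor_of_pushforward_ne_zero`).
[cite: Tate1994, §1] [cite: Kleiman1968AlgebraicCycles, §1.2 Prop. 1.2.4] -/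
theorem tateConjectureFor_and_semisimplicity_of_pushforward_ne_zero (hV : IsSmoothProjective N V)
    (hU : IsSmoothProjective M U) (f : V ⟶ U) {ζ : E.obj V (2 * r)}
    (hζ : ζ ∈ E.ratAlgebraicClasses V r) {he : 2 * r + 2 * M = 2 * N} {hd : 0 + 2 * M = 2 * M}
    (hne : E.pushforward (N := N) hU f he hd ζ ≠ 0) {p : ℕ}
    (h : E.TateConjectureFor V p ∧ E.TateSemisimplicityFor V (2 * p)) :
    E.TateConjectureFor U p ∧ E.TateSemisimplicityFor U (2 * p) :=
  ⟨E.tateConjectureFor_of_pushforward_ne_zero hV hU f hζ hne h.1,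
    E.tateSemisimplicityFor_of_pushforward_ne_zero hV hU f hζ hne h.2⟩

/-! ## Dimensions of Galois invariants and Tate classes do not increase -/

/-- **`dim (Hⁱ(U)(j))^Γ ≤ dim (Hⁱ(V)(j))^Γ`** when `f* : Hⁱ(U) → Hⁱ(V)` is injective: `f*` maps
invariants to invariants (`pullback_mem_invariants`). [cite: Tate1994, §1] -/
theorem finrank_invariants_le_of_pullback_injective (hV : IsSmoothProjective N V)
    (hU : IsSmoothProjective M U) (f : V ⟶ U) {i : ℕ} (j : ℤ)
    (hinj : Function.Injective (E.pullback f i)) :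
    Module.finrank K (E.ρTwist U i j).invariants ≤ Module.finrank K (E.ρTwist V i j).invariants := by
  haveI := E.finite_obj hV i
  exact LinearMap.finrank_le_finrank_of_injective
    (f := (E.pullback f i).restrict fun x hx ↦ E.pullback_mem_invariants hV hU f hx)
    fun a b h ↦ Subtype.ext (hinj (congrArg Subtype.val h))

/-- **`dim Tateᵖ(U) ≤ dim Tateᵖ(V)`** when `f* : H²ᵖ(U) → H²ᵖ(V)` is injective (`f*` maps Tate
classes to Tate classes, `pullback_mem_tateClasses`). [cite: Tate1994, §1] -/
theorem finrank_tateClasses_le_of_pullback_injective (hV : IsSmoothProjective N V)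
    (hU : IsSmoothProjective M U) (f : V ⟶ U) {p : ℕ}
    (hinj : Function.Injective (E.pullback f (2 * p))) :
    Module.finrank K (E.tateClasses U p) ≤ Module.finrank K (E.tateClasses V p) := by
  haveI := E.finite_obj hV (2 * p)
  exact LinearMap.finrank_le_finrank_of_injective
    (f := (E.pullback f (2 * p)).restrict fun x hx ↦ E.pullback_mem_tateClasses hV hU f hx)
    fun a b h ↦ Subtype.ext (hinj (congrArg Subtype.val h))

/-- `dim Tateᵖ(U) ≤ dim Tateᵖ(V)` for `U` dominated by `V` (`f₊ ζ ≠ 0`; Kleiman 1968 Prop. 1.2.4).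
[cite: Tate1994, §1] [cite: Kleiman1968AlgebraicCycles, §1.2 Prop. 1.2.4] -/
theorem finrank_tateClasses_le_of_pushforward_ne_zero (hV : IsSmoothProjective N V)
    (hU : IsSmoothProjective M U) (f : V ⟶ U) {ζ : E.obj V (2 * r)}
    (hζ : ζ ∈ E.ratAlgebraicClasses V r) {he : 2 * r + 2 * M = 2 * N} {hd : 0 + 2 * M = 2 * M}
    (hne : E.pushforward (N := N) hU f he hd ζ ≠ 0) (p : ℕ) :
    Module.finrank K (E.tateClasses U p) ≤ Module.finrank K (E.tateClasses V p) :=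
  E.finrank_tateClasses_le_of_pullback_injective hV hU f
    (E.pullback_injective_of_pushforward_ne_zero hV hU f hζ hne (2 * p))

/-- `dim Tateᵖ(X) ≤ dim Tateᵖ(X × Z)` for all smooth projective `X`, `Z`. [cite: Tate1994, §1] -/
theorem finrank_tateClasses_le_tensor (hX : IsSmoothProjective n X) (hZ : IsSmoothProjective m Z)
    (p : ℕ) :
    Module.finrank K (E.tateClasses X p) ≤ Module.finrank K (E.tateClasses (X ⊗ Z) p) :=
  E.finrank_tateClasses_le_of_pullback_injective (IsSmoothProjective.tensor_holds hX hZ) hX (fst X Z)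
    (E.pullback_fst_injective hX hZ (2 * p))

end GaloisWeilCohomology

end Literature.AlgebraicGeometry.Motives

end
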